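/-
Copyright (c) 2026 the pub-hodgecm-mathlib formalisation cell (harness21).  Prover seat hodgecm-mathlib-LH4-p10 (g3): dealer LH4-plan (g12) WORD #21 «SOCKET READER for (ρ2b′-X)» —
the reader's tie leg between LH4-p04 (g3)'s T5s-U head and the ★ hOrg interface of LH4-p14 (g3)'s layer 4 (p857277).  2026-09-04.
-/
import Summits.HodgeConjecture.HodgeConjecture.Theorems.F0P3cDyRamToricCensusSumUnr   -- ★ (LH4-p04 (g3)): `toricCensusSum_unr` — T5s «TORIC CENSUS SUM», type U, range-sum form
import Mathlib.Algebra.Ring.GeomSum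
import HarnessLib

/-!
# F0 · P3c · line LH4 «(D-RAM) FOUR-FRAME» — (ρ2b′-X) road, O-Sum type U IN THE SHAPE OF THE ★ hOrg G-SIDE CLAUSE (socket-reader adapter)

Cell `pub/hodgecm-mathlib`, crux H413 = `stmt-HodgeConjecture-24833` (helper lane `--supports stmt-HodgeConjecture-24833 --as helper`), route HCCMUnconditional; THEOREMS ONLY
(one theorem, pure `ℚ`-algebra; no definition, no instance, no notation, no `sorry`).

WHY.  ★ `toricCensusSum_unr` (LH4-p04 (g3)) concludes `ε·Σ_j Σ_a q^a·(vP − vM) = q^m·((1 + (q+1)·Σ_{i<n_H} q^i) − 2·Σ_{i<S} q^i)` with `n_H := (jl + S − 2)∕2`, `S = d − d%2`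
(the `N_V − 2[S]_q` form of LH4-p14 (g3)'s census), while the ★ INTEGER INTERFACE hOrg of layer 4 (p857277 `latticeCensus_literals_of_signedCensus`, G-side clause) prints
`(q_w − 1)·(N t_h − N t_a) = ε_t·q_w^{m}·((q_w + 1)·q_w^{n_H} − 2·q_w^{d − d%2})`.  This file is the one-line bridge the G-side organ quotes: the SAME binders as the ★ head plus the
H-side exponent `nH` with `2·nH + 2 = jl + (d − d%2)`, conclusion MULTIPLIED THROUGH by `q − 1` (★ `geom_sum_mul` twice) with `ε` moved to hOrg's side (`ε² = 1` from `hreal`):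
`toricCensusSum_unr_hOrgForm : (q − 1)·Σ_j Σ_a q^a·(vP j a − vM j a) = ε·q^m·((q + 1)·q^{nH} − 2·q^{d − d%2})`.
HONEST LABEL: HC_CM is proved only modulo the 7 printed citations (2 remaining: hLiu418 = stmt-HodgeConjecture-24832, h413 = stmt-HodgeConjecture-24833) until rung 0 closes;
count-neutral arithmetic; (ρ2b′-X) stays OPEN modulo the organ package hOrg.

## References
* [Rogawski1990] J. D. Rogawski, *Automorphic Representations of Unitary Groups in Three Variables*, Ann. of Math. Stud. 123 (1990): §4.9 Prop. 4.9.1 (b) p. 55, Lemma 4.9.3 p. 56.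
* [Kottwitz1986BaseChangeUnits] R. Kottwitz, *Base change for unit elements of Hecke algebras*, Compositio Math. 60 (1986), §1 pp. 240–241.
-/

set_option autoImplicit false

namespace Summit.HodgeConjecture.HodgeConjecture.Cruxes.H413.F0P3cDyRamToricCensusSumUnrHOrgForm

open Finset
open Summit.HodgeConjecture.HodgeConjecture.Cruxes.H413.F0P3cDyRamToricCensusSumUnr (toricCensusSum_unr)

/-- **T5s-U IN THE SHAPE OF THE ★ hOrg G-SIDE CLAUSE** (★ p857277 `latticeCensus_literals_of_signedCensus`, binder `hOrg`, G-side: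
`(q_w − 1)·(N t_h − N t_a) = ε_t·q_w^{m}·((q_w + 1)·q_w^{n_H} − 2·q_w^{d − d%2})`).  Same binders as ★ `toricCensusSum_unr` (LH4-p04 (g3)) plus the H-side exponent `nH` with
`2·nH + 2 = jl + (d − d%2)`; conclusion MULTIPLIED THROUGH by `q − 1` (no geometric `Finset.range` sums) and with `ε` on the hOrg side (`ε² = 1`):
`(q − 1)·Σ_j Σ_a q^a·(vP − vM) = ε·q^m·((q + 1)·q^{nH} − 2·q^{d − d%2})` over `ℚ` — so the G-side organ of (ρ2b′-XLit) quotes it after ONE `Nat.cast`∕`Int.cast`.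
Pure algebra: ★ head, `geom_sum_mul` twice. [cite: Rogawski1990, §4.9 Prop. 4.9.1 (b) p. 55, Lemma 4.9.3 p. 56] [cite: Kottwitz1986BaseChangeUnits, §1 pp. 240–241] -/
theorem toricCensusSum_unr_hOrgForm (q : ℕ) {d jl m : ℕ} (ε : ℚ) (hq : 2 ≤ q) (hd : 2 ≤ d) (hjl : jl % 2 = 0)
    (hreal : (ε = 1 ∧ m % 2 = d % 2 ∧ 1 ≤ m ∧ m + d ≤ jl) ∨ (ε = -1 ∧ m = jl - d + 1 ∧ d ≤ jl))
    (nP nM vP vM : ℕ → ℕ → ℚ)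
    (hnP : ∀ j a, 1 ≤ a → nP j a = if a + d ≤ j ∧ (j - a - d) % 2 = 0 then ((q : ℚ) ^ 2 - 1) * (q : ℚ) ^ (j - 2 - (j - a - d) / 2) else 0)
    (hnP0 : ∀ j, nP j 0 = if (j + d) % 2 = 0 then (if d ≤ j then ((q : ℚ) + 1) * (q : ℚ) ^ ((j + d) / 2 - 1) else (if j = 0 then 1 else ((q : ℚ) + 1) * (q : ℚ) ^ (j - 1))) else 0)
    (hnM : ∀ j a, nM j a = if (d ≤ j + 1 ∧ a + d = j + 1) ∨ (j + 1 < d ∧ a = 0 ∧ (j + d) % 2 = 1) then (if j = 0 then 1 else ((q : ℚ) + 1) * (q : ℚ) ^ (j - 1)) else 0)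
    (hv0 : ∀ j, vP j 0 = nP j 0 ∧ vM j 0 = nM j 0)
    (hvOff : ∀ j a, 1 ≤ a → j + m ≠ jl + a →
      (vP j a = if 2 * a ≤ m ∧ (j + a ≤ m ∨ j + a ≤ jl) then nP j a else 0) ∧ (vM j a = if 2 * a ≤ m ∧ (j + a ≤ m ∨ j + a ≤ jl) then nM j a else 0))
    (hvLow : ∀ j a, 1 ≤ a → j + m = jl + a → 2 * a ≤ m → vP j a = nP j a ∧ vM j a = nM j a)
    (hvTopP : ∀ j a, 1 ≤ a → j + m = jl + a → m < 2 * a →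
      vP j a = if d + m ≤ jl ∧ j < jl then nP j a / (((q : ℚ) - 1) * (q : ℚ) ^ ((2 * a - m + 1) / 2 - 1)) else 0)
    (hvTopM : ∀ j a, 1 ≤ a → j + m = jl + a → m < 2 * a →
      vM j a = if jl + 1 = d + m ∧ j < jl then nM j a / (q : ℚ) ^ ((2 * a - m) / 2) else 0)
    (nH : ℕ) (hnH : 2 * nH + 2 = jl + (d - d % 2)) :
    ((q : ℚ) - 1) * ∑ j ∈ range (jl + 1), ∑ a ∈ range (jl + 2), (q : ℚ) ^ a * (vP j a - vM j a) =
      ε * (q : ℚ) ^ m * (((q : ℚ) + 1) * (q : ℚ) ^ nH - 2 * (q : ℚ) ^ (d - d % 2)) := by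
  have h := toricCensusSum_unr q ε hq hd hjl hreal nP nM vP vM hnP hnP0 hnM hv0 hvOff hvLow hvTopP hvTopM
  have hε : ε * ε = 1 := by
    rcases hreal with ⟨rfl, -⟩ | ⟨rfl, -⟩ <;> norm_num
  have hnH' : (jl + (d - d % 2) - 2) / 2 = nH := by omega
  rw [hnH'] at h
  -- `S = ε·q^m·(…)` by `ε² = 1`
  have hS : ∑ j ∈ range (jl + 1), ∑ a ∈ range (jl + 2), (q : ℚ) ^ a * (vP j a - vM j a) =
      ε * ((q : ℚ) ^ m * ((1 + ((q : ℚ) + 1) * ∑ i ∈ range nH, (q : ℚ) ^ i) - 2 * ∑ i ∈ range (d - d % 2), (q : ℚ) ^ i)) := by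
    have h2 : ε * (ε * ∑ j ∈ range (jl + 1), ∑ a ∈ range (jl + 2), (q : ℚ) ^ a * (vP j a - vM j a)) =
        ε * ((q : ℚ) ^ m * ((1 + ((q : ℚ) + 1) * ∑ i ∈ range nH, (q : ℚ) ^ i) - 2 * ∑ i ∈ range (d - d % 2), (q : ℚ) ^ i)) := by rw [h]
    rwa [← mul_assoc, hε, one_mul] at h2
  -- clear the two geometric sums with `q − 1`
  have hg1 : ((q : ℚ) - 1) * ∑ i ∈ range nH, (q : ℚ) ^ i = (q : ℚ) ^ nH - 1 := by
    rw [mul_comm]; exact geom_sum_mul _ _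
  have hg2 : ((q : ℚ) - 1) * ∑ i ∈ range (d - d % 2), (q : ℚ) ^ i = (q : ℚ) ^ (d - d % 2) - 1 := by
    rw [mul_comm]; exact geom_sum_mul _ _
  have hkey : ((q : ℚ) - 1) * ((1 + ((q : ℚ) + 1) * ∑ i ∈ range nH, (q : ℚ) ^ i) - 2 * ∑ i ∈ range (d - d % 2), (q : ℚ) ^ i) =
      ((q : ℚ) + 1) * (q : ℚ) ^ nH - 2 * (q : ℚ) ^ (d - d % 2) := by
    have e : ((q : ℚ) - 1) * ((1 + ((q : ℚ) + 1) * ∑ i ∈ range nH, (q : ℚ) ^ i) - 2 * ∑ i ∈ range (d - d % 2), (q : ℚ) ^ i) =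
        ((q : ℚ) - 1) + ((q : ℚ) + 1) * (((q : ℚ) - 1) * ∑ i ∈ range nH, (q : ℚ) ^ i) -
          2 * (((q : ℚ) - 1) * ∑ i ∈ range (d - d % 2), (q : ℚ) ^ i) := by ring
    rw [e, hg1, hg2]; ring
  rw [hS]
  calc ((q : ℚ) - 1) * (ε * ((q : ℚ) ^ m * ((1 + ((q : ℚ) + 1) * ∑ i ∈ range nH, (q : ℚ) ^ i) - 2 * ∑ i ∈ range (d - d % 2), (q : ℚ) ^ i)))
        = ε * (q : ℚ) ^ m * (((q : ℚ) - 1) * ((1 + ((q : ℚ) + 1) * ∑ i ∈ range nH, (q : ℚ) ^ i) - 2 * ∑ i ∈ range (d - d % 2), (q : ℚ) ^ i)) := by ring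
    _ = ε * (q : ℚ) ^ m * (((q : ℚ) + 1) * (q : ℚ) ^ nH - 2 * (q : ℚ) ^ (d - d % 2)) := by rw [hkey]

end Summit.HodgeConjecture.HodgeConjecture.Cruxes.H413.F0P3cDyRamToricCensusSumUnrHOrgForm
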